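import Summits.ResolutionOfSingularities.ResolutionOfSingularities.Theorems.HilbertSamuelEliminationSigmaMaxModificationsCorridor3WLadderIsoInsepE2NearCubic
import Mathlib.RingTheory.Polynomial.Quotient
import Mathlib.RingTheory.PrincipalIdealDomain
import HarnessLib

/-!
# [OURS · L1 W4.2] E2 chart calculus, brick 15: THE POINT OF THE LINE AS A PRIME OF `κ[T]` — restriction to the line
# `κ[T_k] → κ[X]` (all variables but one killed), `𝔭 ↔ 𝔭₁ = (P)`, «`f ∈ 𝔭⁽²⁾ ⇒ P² | f|_line`», and the RC degree count
# «`g ≠ 0`, `deg g ≤ 3`, `P | g`, `P² | g` ⇒ `deg P = 1`» (crux chain w42, cell k2 `T3insep` = `stub_isoInsepTower`;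
# `--supports stmt-ResolutionOfSingularities-19249`)

OURS (cell res-hironaka, slot W4.2, seat res-D-pv-042; OWN OBJECT TUO 18:19Z, (N3) continuation); NOT a statement of [Hironaka2017]
nor of [CossartJannsenSaito2020] / [CossartPiltant2008]. AI-drafted, weaker than expert review. PROOF file, def-free, fact-free.
Pure polynomial algebra over a field `κ`; `ι` any index type, `c : ι` the surviving variable, `𝔭` a prime of `κ[T_k : k ∈ ι]` containing every
`T_k`, `k ≠ c` (a point of the line `V(T_k : k ≠ c)`); the restriction `ρ = aeval (T_c ↦ X, T_k ↦ 0)` and the section `X ↦ T_c`.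

* `aeval_line_section` — `ρ(p(T_c)) = p`.
* `sub_section_lineRestriction_mem` — `f − (ρ f)(T_c) ∈ 𝔭`; `mem_iff_lineRestriction_mem` — `f ∈ 𝔭 ⟺ ρ f ∈ 𝔭₁`, `𝔭₁ := 𝔭 ∩ κ[T_c]`
  (the comap along the section); `lineRestriction_not_mem_of_not_mem`.
* `exists_mul_lineRestriction_mem_sq` — `f/1 ∈ 𝔪²` in `κ[T]_𝔭` ⇒ `s·ρ(f) ∈ 𝔭₁²` for some `s ∉ 𝔭₁`; `generator_sq_dvd_lineRestriction`
  — hence `P² ∣ ρ f` for a generator `P` of the principal prime `𝔭₁`; `generator_dvd_lineRestriction` — `f ∈ 𝔭 ⇒ P ∣ ρ f`.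
* `natDegree_generator_eq_one` — **the RC degree count**: `g ≠ 0`, `deg g ≤ 3`, `P ∣ g`, `P² ∣ g`, `(P)` a proper ideal ⇒ `deg P = 1`.
-/

noncomputable section

set_option linter.dupNamespace false

open scoped Classical
open IsLocalRing MvPolynomial

namespace Summit.ResolutionOfSingularities.ResolutionOfSingularities.Cruxes.SigmaMaxModifications.IdeasL1C6.E2Chart

universe u v

section LinePrime

variable {κ : Type u} [Field κ] {ι : Type v} [DecidableEq ι] (c : ι)

/-- `ρ(p(T_c)) = p` for the restriction `ρ : T_c ↦ X, T_k ↦ 0` and the section `X ↦ T_c`. [folklore] -/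
theorem aeval_line_section (p : Polynomial κ) :
    MvPolynomial.aeval (fun k : ι => if k = c then (Polynomial.X : Polynomial κ) else 0)
      (Polynomial.aeval (X c : MvPolynomial ι κ) p) = p := by
  rw [← AlgHom.comp_apply, ← Polynomial.aeval_algHom, MvPolynomial.aeval_X, if_pos rfl, Polynomial.aeval_X_left_apply]

/-- The section followed by the restriction, on a polynomial in all variables: `(ρ f)(T_c) = f(T_c ↦ T_c, T_k ↦ 0)`. [folklore] -/
theorem section_lineRestriction (f : MvPolynomial ι κ) :
    Polynomial.aeval (X c : MvPolynomial ι κ)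
        (MvPolynomial.aeval (fun k : ι => if k = c then (Polynomial.X : Polynomial κ) else 0) f) =
      MvPolynomial.aeval (fun k : ι => if k = c then (X c : MvPolynomial ι κ) else 0) f := by
  rw [← AlgHom.comp_apply, MvPolynomial.comp_aeval]
  have hfun : (fun i : ι => Polynomial.aeval (X c : MvPolynomial ι κ) (if i = c then (Polynomial.X : Polynomial κ) else 0)) =
      fun k : ι => if k = c then (X c : MvPolynomial ι κ) else 0 := by
    funext k
    by_cases hk : k = c
    · subst hk; rw [if_pos rfl, if_pos rfl, Polynomial.aeval_X]
    · rw [if_neg hk, if_neg hk, map_zero]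
  rw [hfun]

variable (𝔭 : Ideal (MvPolynomial ι κ)) (hvars : ∀ k : ι, k ≠ c → (X k : MvPolynomial ι κ) ∈ 𝔭)
include hvars

/-- At a point of the line `V(T_k : k ≠ c)`: `f − (ρ f)(T_c) ∈ 𝔭`. [folklore] -/
theorem sub_section_lineRestriction_mem (f : MvPolynomial ι κ) :
    f - Polynomial.aeval (X c : MvPolynomial ι κ)
        (MvPolynomial.aeval (fun k : ι => if k = c then (Polynomial.X : Polynomial κ) else 0) f) ∈ 𝔭 := by
  rw [section_lineRestriction]
  have h := aeval_sub_aeval_mem_of_forall_sub_mem 𝔭 (a := fun k : ι => (X k : MvPolynomial ι κ))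
    (b := fun k : ι => if k = c then (X c : MvPolynomial ι κ) else 0) (fun k => by
      by_cases hk : k = c
      · subst hk; simp
      · simp only [if_neg hk, sub_zero]; exact hvars k hk) f
  rwa [MvPolynomial.aeval_X_left_apply] at h

/-- **`f ∈ 𝔭 ⟺ ρ f ∈ 𝔭₁`**, `𝔭₁ = 𝔭 ∩ κ[T_c]` the comap along the section. [folklore] -/
theorem mem_iff_lineRestriction_mem (f : MvPolynomial ι κ) :
    f ∈ 𝔭 ↔ MvPolynomial.aeval (fun k : ι => if k = c then (Polynomial.X : Polynomial κ) else 0) f ∈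
      𝔭.comap (Polynomial.aeval (X c : MvPolynomial ι κ)) := by
  rw [Ideal.mem_comap]
  have h := sub_section_lineRestriction_mem c 𝔭 hvars f
  constructor
  · intro hf
    have := sub_mem hf h
    rwa [sub_sub_cancel] at this
  · intro hf
    have := add_mem h hf
    rwa [sub_add_cancel] at this

/-- The restriction maps `𝔭` into `𝔭₁`. [folklore] -/
theorem map_lineRestriction_le :
    𝔭.map (MvPolynomial.aeval (fun k : ι => if k = c then (Polynomial.X : Polynomial κ) else 0)) ≤
      𝔭.comap (Polynomial.aeval (X c : MvPolynomial ι κ)) := by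
  rw [Ideal.map_le_iff_le_comap]
  intro f hf
  exact (mem_iff_lineRestriction_mem c 𝔭 hvars f).mp hf

/-- **Symbolic square ⇒ square on the line.** If `f/1 ∈ 𝔪²` in `κ[T]_𝔭` then `s · ρ(f) ∈ 𝔭₁²` for some `s ∉ 𝔭₁`. [folklore] -/
theorem exists_mul_lineRestriction_mem_sq [𝔭.IsPrime] {f : MvPolynomial ι κ}
    (hf : algebraMap (MvPolynomial ι κ) (Localization.AtPrime 𝔭) f ∈ maximalIdeal (Localization.AtPrime 𝔭) ^ 2) :
    ∃ s : Polynomial κ, s ∉ 𝔭.comap (Polynomial.aeval (X c : MvPolynomial ι κ)) ∧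
      s * MvPolynomial.aeval (fun k : ι => if k = c then (Polynomial.X : Polynomial κ) else 0) f ∈
        (𝔭.comap (Polynomial.aeval (X c : MvPolynomial ι κ))) ^ 2 := by
  rw [← Localization.AtPrime.map_eq_maximalIdeal, ← Ideal.map_pow,
    IsLocalization.mem_map_algebraMap_iff 𝔭.primeCompl (Localization.AtPrime 𝔭)] at hf
  obtain ⟨⟨⟨i, hi⟩, ⟨s, hs⟩⟩, h⟩ := hf
  haveI : IsDomain (MvPolynomial ι κ) := inferInstance
  have hinj := IsLocalization.injective (Localization.AtPrime 𝔭) 𝔭.primeCompl_le_nonZeroDivisors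
  have hfs : f * s = i := hinj (by rw [map_mul]; exact h)
  set ρ : MvPolynomial ι κ →ₐ[κ] Polynomial κ :=
    MvPolynomial.aeval (fun k : ι => if k = c then (Polynomial.X : Polynomial κ) else 0) with hρ
  refine ⟨ρ s, fun hs' => hs ((mem_iff_lineRestriction_mem c 𝔭 hvars s).mpr hs'), ?_⟩
  have hmem : ρ i ∈ (𝔭.comap (Polynomial.aeval (X c : MvPolynomial ι κ))) ^ 2 := by
    refine Ideal.pow_right_mono (map_lineRestriction_le c 𝔭 hvars) 2 ?_
    rw [← Ideal.map_pow]
    exact Ideal.mem_map_of_mem _ hi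
  rw [← hfs, map_mul, mul_comm] at hmem
  exact hmem

/-- **`P² ∣ ρ(f)`** for a generator `P` of the principal prime `𝔭₁` when `f/1 ∈ 𝔪²` (the case `P = 0` included: then `ρ f = 0`).
[folklore] -/
theorem generator_sq_dvd_lineRestriction [𝔭.IsPrime] {P : Polynomial κ}
    (hP : 𝔭.comap (Polynomial.aeval (X c : MvPolynomial ι κ)) = Ideal.span {P}) {f : MvPolynomial ι κ}
    (hf : algebraMap (MvPolynomial ι κ) (Localization.AtPrime 𝔭) f ∈ maximalIdeal (Localization.AtPrime 𝔭) ^ 2) :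
    P ^ 2 ∣ MvPolynomial.aeval (fun k : ι => if k = c then (Polynomial.X : Polynomial κ) else 0) f := by
  obtain ⟨s, hs, hsf⟩ := exists_mul_lineRestriction_mem_sq c 𝔭 hvars hf
  rw [hP, Ideal.mem_span_singleton] at hs
  rw [hP, Ideal.span_singleton_pow, Ideal.mem_span_singleton] at hsf
  by_cases hP0 : P = 0
  · subst hP0
    rw [zero_pow two_ne_zero, zero_dvd_iff] at hsf ⊢
    rw [zero_dvd_iff] at hs
    exact (mul_eq_zero.mp hsf).resolve_left hs
  · have hprime : Prime P := by
      rw [← Ideal.span_singleton_prime hP0, ← hP]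
      exact Ideal.comap_isPrime _ 𝔭
    exact hprime.pow_dvd_of_dvd_mul_left 2 hs hsf

/-- **`P ∣ ρ(f)`** when `f ∈ 𝔭`. [folklore] -/
theorem generator_dvd_lineRestriction {P : Polynomial κ}
    (hP : 𝔭.comap (Polynomial.aeval (X c : MvPolynomial ι κ)) = Ideal.span {P}) {f : MvPolynomial ι κ} (hf : f ∈ 𝔭) :
    P ∣ MvPolynomial.aeval (fun k : ι => if k = c then (Polynomial.X : Polynomial κ) else 0) f := by
  have := (mem_iff_lineRestriction_mem c 𝔭 hvars f).mp hf
  rwa [hP, Ideal.mem_span_singleton] at this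

omit hvars in
/-- **The RC degree count.** Over a field: `g ≠ 0`, `deg g ≤ 3`, `P ∣ g`, `P² ∣ g` and `(P)` a prime ideal ⇒ `deg P = 1` (so `κ[X]/(P) = κ`:
the point of the line is RATIONAL). [folklore] -/
theorem natDegree_generator_eq_one {P g : Polynomial κ} (hprime : (Ideal.span {P}).IsPrime) (hg0 : g ≠ 0)
    (hdeg : g.natDegree ≤ 3) (h1 : P ∣ g) (h2 : P ^ 2 ∣ g) : P.natDegree = 1 := by
  have hP0 : P ≠ 0 := by
    rintro rfl
    exact hg0 (zero_dvd_iff.mp h1)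
  have hPu : ¬ IsUnit P := fun hu => hprime.ne_top (Ideal.span_singleton_eq_top.mpr hu)
  have hpos : 0 < P.natDegree := Polynomial.natDegree_pos_iff_degree_pos.mpr (Polynomial.degree_pos_of_ne_zero_of_nonunit hP0 hPu)
  have hle : (P ^ 2).natDegree ≤ g.natDegree := Polynomial.natDegree_le_of_dvd h2 hg0
  rw [Polynomial.natDegree_pow] at hle
  omega

end LinePrime

end Summit.ResolutionOfSingularities.ResolutionOfSingularities.Cruxes.SigmaMaxModifications.IdeasL1C6.E2Chart

end
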